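import Literature.NumberTheory.NumberFields.SemilocalNormPlaces
import Literature.NumberTheory.GaloisRepresentations.SemiLocalUnitGroupPlaceSummands
import HarnessLib

/-!
# A map `∏_{w'∣v} U¹_{w'}(F) → ∏_{w₀∣v} U¹_{w₀}(K₀)` whose components are products of local norms is BLOCK COMPATIBLE: an element supported at one place `w'`
# goes to an element supported at the place `w' ∩ K₀` below, with component `N_{F_{w'}/(K₀)_{w'∩K₀}}` of the `w'`-component (Cassels–Fröhlich II §11)

Topic `NumberTheory/NumberFields`; namespace `Literature.NumberTheory.NumberFields.Semilocal`, continuing `SemilocalNormPlaces.lean` (★★★ the semi-local norm / ty2's `normU` read at a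
place `w₀` is `∏_{w∣w₀} N_{F_w/(K₀)_{w₀}}`, `IsNormCompatible.unitsToSemiLocal_eq_prod_algebraNorm`; tower form `EllipticUnits/SemilocalUnitTowerNormPlaces`) and
`SemilocalPrincipalUnitsPlacesTower.lean` (`placeUnder`, `placeOver`, `extensionOfPlace`).  For a tower of number fields `K ⊆ K₀ ⊆ F` and ANY additive map
`f : ∏_{w'∣v} U¹_{w'}(F) → ∏_{w₀∣v} U¹_{w₀}(K₀)` (place models `SemiLocal.principalUnitGroup`) satisfying the component formula
`(f y')_{w₀} = ∏_{w∣w₀} N_{F_w/(K₀)_{w₀}}((y')_{w})` (hypothesis `hf` — discharged for the semi-local norm by the files above):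
* `placeUnder_extensionOfPlace`, `extensionOfPlace_placeUnder_placeOver`, `extensionOfPlace_injective` (bookkeeping of places in the tower);
* ★★ **`map_principalPlaceSummand_le_of_components`** — `f` maps the summand `U¹_{w'}` (elements supported at `w'`) into the summand `U¹_{w'∩K₀}`: BLOCK COMPATIBILITY
  (the hypothesis `hblock`/`hfi` of the orbit-factor naturality `Algebra/Homology/TwistedCoinvariantsOrbitFactorsNaturality`);
* ★★ **`coe_apply_placeUnder_of_mem_principalPlaceSummand`** — for `y'` supported at `w'`, the `w'∩K₀`-component of `f y'` is the LOCAL NORM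
  `N_{F_{w'}/(K₀)_{w'∩K₀}}((y')_{w'})` (all other factors are norms of `1`).
Use (cell `bsd-print-cf2`, brick §4(c)/(e)): with `f` = the place-model transport of ty2's `normU` these are the two inputs that make the transition maps of
`lim←_{(n,k)} tLayerCoinvEquivPiOrbits` the local norms of the `𝔓`-tower, orbit factor by orbit factor.  Theorems only; no definition, no named fact, no `sorry`, no instance.

## References
* [CasselsFrohlichANT1967] J. W. S. Cassels, A. Fröhlich (eds.), *Algebraic Number Theory* (1967), Ch. II (Cassels) §10 (10.2), §11 (local and global norms).
* [deShalit1987] E. de Shalit, *Iwasawa theory of elliptic curves with complex multiplication* (1987), III §1.2 (2), §1.3.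
* [Brown1982CohomologyGroups] K. S. Brown, *Cohomology of Groups* (1982), III §5 Prop. (5.3), (5.8).
-/

noncomputable section

open NumberField IsDedekindDomain
open Literature.NumberTheory.GaloisRepresentations Literature.NumberTheory.Automorphic
open Literature.Algebra.Homology Literature.Algebra.Homology.InducedModule

namespace Literature.NumberTheory.NumberFields.Semilocal

-- number fields in `Type` (the place-model `SemiLocal.principalUnitGroup` is stated in `Type`, as in `SemiLocalUnitGroupPlaceSummands`)
variable (K : Type) [Field K] [NumberField K] (v : HeightOneSpectrum (𝓞 K))
  (K₀ : Type) [Field K₀] [NumberField K₀] [Algebra K K₀]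
  (F : Type) [Field F] [NumberField F] [Algebra K F] [Algebra K₀ F] [IsScalarTower K K₀ F]

/-! ### Places in the tower: bookkeeping -/

/-- The place below `extensionOfPlace w₀ w` is `w₀`. [cite: CasselsFrohlichANT1967, Ch. II §10] -/
@[simp] theorem placeUnder_extensionOfPlace (w₀ : v.Extension (𝓞 K₀)) (w : SemiLocal.Place K₀ F w₀.1) :
    placeUnder K v K₀ F (extensionOfPlace K v K₀ F w₀ w) = w₀ :=
  Subtype.ext w.under_eq

/-- `w' = extensionOfPlace (w' ∩ K₀) (w' as a place above w' ∩ K₀)`. [cite: CasselsFrohlichANT1967, Ch. II §10] -/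
@[simp] theorem extensionOfPlace_placeUnder_placeOver (w' : v.Extension (𝓞 F)) :
    extensionOfPlace K v K₀ F (placeUnder K v K₀ F w') (placeOver K v K₀ F w') = w' := rfl

/-- `extensionOfPlace w₀` is injective on the places above `w₀`. [cite: CasselsFrohlichANT1967, Ch. II §10] -/
theorem extensionOfPlace_injective (w₀ : v.Extension (𝓞 K₀)) : Function.Injective (extensionOfPlace K v K₀ F w₀) :=
  fun _ _ h => SemiLocal.Place.ext (congrArg (fun w : v.Extension (𝓞 F) => w.1) h)

/-! ### Block compatibility and the local norm on one block -/

variable {K v K₀ F}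
variable (f : Additive ↥(SemiLocal.principalUnitGroup K F v) →+ Additive ↥(SemiLocal.principalUnitGroup K K₀ v))
  (hf : ∀ (y' : Additive ↥(SemiLocal.principalUnitGroup K F v)) (w₀ : v.Extension (𝓞 K₀)),
    ((Additive.toMul (f y') : ↥(SemiLocal.principalUnitGroup K K₀ v)) : (SemiLocal K K₀ v)ˣ).1 (extensionEquivPlace K v K₀ w₀) =
      ∏ w : SemiLocal.Place K₀ F w₀.1, @Algebra.norm (w₀.1.adicCompletion K₀) ((w : HeightOneSpectrum (𝓞 F)).adicCompletion F) _ _ (SemiLocal.algebraPlace w)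
        (((Additive.toMul y' : ↥(SemiLocal.principalUnitGroup K F v)) : (SemiLocal K F v)ˣ).1 (extensionEquivPlace K v F (extensionOfPlace K v K₀ F w₀ w))))

/-- An element supported at `w'` has component `1` at every other place. [cite: Brown1982CohomologyGroups, III §5 Prop. (5.8)] -/
theorem coe_apply_eq_one_of_mem_principalPlaceSummand {w' : v.Extension (𝓞 F)} {y' : Additive ↥(SemiLocal.principalUnitGroup K F v)}
    (hy' : y' ∈ SemiLocal.principalPlaceSummand K F v (extensionEquivPlace K v F w')) {w'' : v.Extension (𝓞 F)} (hne : w'' ≠ w') :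
    ((Additive.toMul y' : ↥(SemiLocal.principalUnitGroup K F v)) : (SemiLocal K F v)ˣ).1 (extensionEquivPlace K v F w'') = 1 :=
  (SemiLocal.principalUnitGroupProj_eq_zero_iff _ y').mp ((mem_coordSummand_iff _ _ y').mp hy' _
    fun h => hne ((extensionEquivPlace K v F).injective h))

include hf in
/-- ★★ **BLOCK COMPATIBILITY**: a map with components the products of local norms sends the summand `U¹_{w'}` (elements supported at `w'`) into the summand
`U¹_{w'∩K₀}`. [cite: CasselsFrohlichANT1967, Ch. II §11] [cite: Brown1982CohomologyGroups, III §5 Prop. (5.3)] -/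
theorem map_principalPlaceSummand_le_of_components (w' : v.Extension (𝓞 F)) :
    (SemiLocal.principalPlaceSummand K F v (extensionEquivPlace K v F w')).map f.toIntLinearMap ≤
      SemiLocal.principalPlaceSummand K K₀ v (extensionEquivPlace K v K₀ (placeUnder K v K₀ F w')) := by
  rintro _ ⟨y', hy', rfl⟩
  rw [mem_coordSummand_iff]
  intro w₀'' hne
  rw [SemiLocal.principalUnitGroupProj_eq_zero_iff]
  -- `w₀'' = extensionEquivPlace w₀e` with `w₀e ≠ placeUnder w'`
  obtain ⟨w₀e, rfl⟩ := (extensionEquivPlace K v K₀).surjective w₀''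
  have hne' : w₀e ≠ placeUnder K v K₀ F w' := fun h => hne (by rw [h])
  show ((Additive.toMul (f y') : ↥(SemiLocal.principalUnitGroup K K₀ v)) : (SemiLocal K K₀ v)ˣ).1 (extensionEquivPlace K v K₀ w₀e) = 1
  rw [hf y' w₀e]
  refine Finset.prod_eq_one fun w _ => ?_
  have hw : extensionOfPlace K v K₀ F w₀e w ≠ w' := fun h => hne' (by rw [← h, placeUnder_extensionOfPlace])
  rw [coe_apply_eq_one_of_mem_principalPlaceSummand hy' hw]
  exact map_one _

include hf in
/-- ★★ **THE LOCAL NORM ON ONE BLOCK**: for `y'` supported at `w'`, the `w'∩K₀`-component of `f y'` is `N_{F_{w'}/(K₀)_{w'∩K₀}}((y')_{w'})` (the `(K₀)_{w'∩K₀}`-algebra structure of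
`F_{w'}` being the tree's `SemiLocal.algebraPlace` of `w'` as a place above `w' ∩ K₀`). [cite: CasselsFrohlichANT1967, Ch. II §11] [cite: deShalit1987, III §1.2 (2)] -/
theorem coe_apply_placeUnder_of_mem_principalPlaceSummand {w' : v.Extension (𝓞 F)} {y' : Additive ↥(SemiLocal.principalUnitGroup K F v)}
    (hy' : y' ∈ SemiLocal.principalPlaceSummand K F v (extensionEquivPlace K v F w')) :
    ((Additive.toMul (f y') : ↥(SemiLocal.principalUnitGroup K K₀ v)) : (SemiLocal K K₀ v)ˣ).1 (extensionEquivPlace K v K₀ (placeUnder K v K₀ F w')) =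
      @Algebra.norm ((placeUnder K v K₀ F w').1.adicCompletion K₀)
        (((placeOver K v K₀ F w' : SemiLocal.Place K₀ F (placeUnder K v K₀ F w').1) : HeightOneSpectrum (𝓞 F)).adicCompletion F) _ _
        (SemiLocal.algebraPlace (placeOver K v K₀ F w'))
        (((Additive.toMul y' : ↥(SemiLocal.principalUnitGroup K F v)) : (SemiLocal K F v)ˣ).1 (extensionEquivPlace K v F w')) := by
  rw [hf y' (placeUnder K v K₀ F w'), Finset.prod_eq_single (placeOver K v K₀ F w')]
  · rfl
  · intro w _ hw
    have hw' : extensionOfPlace K v K₀ F (placeUnder K v K₀ F w') w ≠ w' := fun h =>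
      hw (extensionOfPlace_injective K v K₀ F _ (h.trans (extensionOfPlace_placeUnder_placeOver K v K₀ F w').symm))
    rw [coe_apply_eq_one_of_mem_principalPlaceSummand hy' hw']
    exact map_one _
  · exact fun h => absurd (Finset.mem_univ _) h

end Literature.NumberTheory.NumberFields.Semilocal

end
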